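import Summits.BirchSwinnertonDyer.BirchSwinnertonDyer.Theorems.ByReductionTypeAtTwoTowerLayerSharp
import Summits.BirchSwinnertonDyer.BirchSwinnertonDyer.Theorems.ByReductionTypeAtTwoTowerLayerGreenbergH33Free
import HarnessLib

/-!
# The sharp-exponent β-currency TOWER doors of `…TowerLayerSharp` with NO tower print binder
# (route ByReductionTypeAtTwo, crux `OrdKatoHalfAtTwo`, item stmt-BirchSwinnertonDyer-19271; seat
# bsd-2adic-tower-eng GEN 7, bonus to WAKE `plan/WAKE-IDLE-2ADIC-h33-rekey.md`)

HONEST FRAMING (cell `bsd-2adic`, run/shared/lean/pub/bsd-2adic/, HUMAN RULINGS D-0036/D-0054/D-0074/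
D-0152): door THEOREMS only; no definition; no new named fact; no `sorry`; closes nothing by itself;
nothing is booked; BSD is NOT proved by any of this. Existing files untouched (append-only tree).

Part 6 (`…TowerLayerSharp.lean`, tower-1 GEN 2) displays three TOWER print binders at the local error
terms: `h33g` / `h33` (Greenberg LNM 1716 Lemma 3.3, `v ∤ 2`) and `h34` (Lemma 3.4 for `ℚ`, `v ∣ 2`:
`#𝒦_{v,n}[2^∞] = |Ẽ(𝔽₂)_2|²`). The sibling `…TowerLayerSharpH33Free` feeds `h33g`/`h33` by the tree's
theorems and keeps `h34`. Here ALL THREE are discharged, on the road tower-1 GEN 11 opened for the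
cert-currency family (`…GoodOrdTowerKernelDoors`): at `v ∣ 2` the kernel theorem
`GoodOrdTower.pTorsion_localTowerKer_at_two_le_four_kernel` (`#𝒦_{v,n}[2] ≤ 4` at a good ordinary `2`,
`κ` cyclotomic, every layer `n`) and `4 ≤ |Ẽ(𝔽₂)_2|²` (`2 ∣ #Ẽ(𝔽₂)` since `a₂` is odd;
`four_le_sq_two_pow_padicValNat_reductionPointCount_two`, sibling `…TowerLayerGreenbergH33Free`) give
part 6's hypothesis (hC) at `2` in the display's own shape; at the odd `v ∈ S`
`lemma33_natCard_localTowerKerPrimary_le_holds` (bsd-cited r20, p614793) + the certificate `β_v`; off `S`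
`lemma33_localTowerKerPrimary_eq_bot_of_good_holds` (tower-1 GEN 3). The six displays re-issued, each =
part 6's statement minus `h33g`, `h33`, `h34`:

* `towerGapAtTwo_of_layerSelmer_beta_kernel_sharp` — `O1.TowerGapAtTwo W` from: good ordinary at `2`,
  odd torsion order, `S`/`hS`, `β`/`hβ`, two layer Selmer counts, the sharp arithmetic; NO print binder;
* `bsdp_two_of_layerSelmer_beta_kernel_sharp`, `mazurMainConjecture_two_of_layerSelmer_beta_kernel_sharp`,
  `katoHalfAt_two_of_layerSelmer_beta_kernel_sharp` — the rank / `λ_an` / `μ_an` road; PRINT left =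
  `h17` (Kato 17.4), `h414` (Prop. 4.14), `hper₀` [+ `hmod`, `hGZK`, `hEC` for `BSDp`];
* `bsdp_two_of_layerSelmer_beta_kernel_sharp_of_missingLowerBoundAt`,
  `mazurMainConjecture_two_of_layerSelmer_beta_kernel_sharp_of_missingLowerBoundAt` — the `Ш`-currency
  road (rank `0`); PRINT left = `hmod`, `hGZK`, `h17`, `hEC`, `hper₀`.

References: R. Greenberg, LNM 1716 (1999), §3 Lemmas 3.3–3.5 (PDF pp. 86–90), Thm. 4.1, Prop. 4.14;
K. Kato, Astérisque 295 (2004), Thm. 17.4; L. Washington, *Introduction to Cyclotomic Fields*, §13;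
B. Mazur, Invent. Math. 18 (1972), §7.
-/

set_option autoImplicit false
-- the Theorems namespace of this sub repeats the summit name by design (D-0017 nested layout: Summit.<S>.<Sub>)
set_option linter.dupNamespace false

noncomputable section

open scoped Classical MatrixGroups ModularForm

open NumberField IsDedekindDomain CongruenceSubgroup WeierstrassCurve Literature.NumberTheory.EllipticCurves
  Literature.NumberTheory.EllipticCurves.ModularForms Literature.NumberTheory.EllipticCurves.Rank1Residual
  Literature.NumberTheory.EllipticCurves.Rank1Residual.Typed
  Literature.NumberTheory.EllipticCurves.Greenberg1999
  Summit.BirchSwinnertonDyer.Rank1Residual.X1.MuLambda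
  Summit.BirchSwinnertonDyer.Rank1Residual.X1.MuPart
  Summit.BirchSwinnertonDyer.Rank1Residual.X1.ParitySqueeze
  Summit.BirchSwinnertonDyer.BirchSwinnertonDyer.Theorems.Rank1ResidualX1Defs
  Summit.BirchSwinnertonDyer.Rank1Residual.X5 Summit.BirchSwinnertonDyer.Rank1Residual.X5.O1
  Summit.BirchSwinnertonDyer.Rank1Residual.X5.TowerGap
  Summit.BirchSwinnertonDyer.Rank1Residual

namespace Summit.BirchSwinnertonDyer.BirchSwinnertonDyer.Theorems.KatoHalfPinch

section Curve

variable (W : WeierstrassCurve ℚ) [W.IsElliptic] [W.IsGloballyMinimal]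

/-- **The GAP certificate, SHARP covers, β-currency, NO tower print binder**: the display
`towerGapAtTwo_of_layerSelmer_of_greenberg_sharp` (part 6) minus `h33g`, `h33`, `h34` — good `v ∤ 2` off
`S` by `lemma33_localTowerKerPrimary_eq_bot_of_good_holds`, odd `v ∈ S` by
`lemma33_natCard_localTowerKerPrimary_le_holds` + the certificate `β_v`, `v ∣ 2` by
`GoodOrdTower.pTorsion_localTowerKer_at_two_le_four_kernel` (`#𝒦_{v,j'}[2] ≤ 4 ≤ |Ẽ(𝔽₂)_2|²`); sharp
covers from part 6's `towerGapAtTwo_of_localKernelBounds_sharp`. Arithmetic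
`2^d · ∏_{v ∈ S} (2 ∈ v ? |Ẽ(𝔽₂)_2|² : β_v)^{(2 ∈ v ? 1 : 2^{min(j', v₂(ℓ_v² − 1) − 3)})} < 2^{2^{j'} − 2^j + a}`.
[cite: GreenbergLNM1716, §3 Lemmas 3.3, 3.4, 3.5 (PDF pp. 86–90)] [cite: Washington1997, §13.1] -/
theorem towerGapAtTwo_of_layerSelmer_beta_kernel_sharp
    (hgo : GoodOrd W 2) (htors : ¬ 2 ∣ W.torsionOrder) {j j' a d : ℕ} (hjj' : j ≤ j')
    (S : Finset (HeightOneSpectrum (𝓞 ℚ)))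
    (hS : ∀ v ∉ S, ((2 : ℕ) : 𝓞 ℚ) ∉ v.asIdeal ∧ W.HasGoodReductionAt v)
    (β : HeightOneSpectrum (𝓞 ℚ) → ℕ)
    (hβ : ∀ κ : ZpExtension ℚ 2, κ.IsCyclotomic → ∀ v ∈ S, ((2 : ℕ) : 𝓞 ℚ) ∉ v.asIdeal →
      Nat.card (↥(W.localTopPrimary κ (v.adicCompletion ℚ)) ⧸
        W.localTopPrimaryDiv κ (v.adicCompletion ℚ)) ≤ β v)
    (hlow : ∀ κ : ZpExtension ℚ 2, κ.IsCyclotomic →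
      2 ^ a ≤ Nat.card {z : W.selmerLayer κ j // 2 • z = 0})
    (hup : ∀ κ : ZpExtension ℚ 2, κ.IsCyclotomic →
      Nat.card {z : W.selmerLayer κ j' // 2 • z = 0} ≤ 2 ^ d)
    (harith : 2 ^ d * ∏ v ∈ S,
        (if ((2 : ℕ) : 𝓞 ℚ) ∈ v.asIdeal then (2 ^ padicValNat 2 (W.reductionPointCount 2)) ^ 2
          else β v) ^
        (if ((2 : ℕ) : 𝓞 ℚ) ∈ v.asIdeal then 1
          else 2 ^ min j' (padicValNat 2 (Rat.HeightOneSpectrum.natGenerator v ^ 2 - 1) - 3)) <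
      2 ^ (2 ^ j' - 2 ^ j + a)) : TowerGapAtTwo W := by
  refine towerGapAtTwo_of_localKernelBounds_sharp W htors hjj' S
    (fun v ↦ if ((2 : ℕ) : 𝓞 ℚ) ∈ v.asIdeal then (2 ^ padicValNat 2 (W.reductionPointCount 2)) ^ 2
      else β v) hlow hup
    (fun κ hκ v hv ↦ lemma33_localTowerKerPrimary_eq_bot_of_good_holds ℚ W 2 κ hκ v (hS v hv).1
      (hS v hv).2 j') (fun κ hκ v hv ↦ ?_) harith
  by_cases h2 : ((2 : ℕ) : 𝓞 ℚ) ∈ v.asIdeal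
  · rw [if_pos h2]
    obtain ⟨hfin, hle⟩ := GoodOrdTower.pTorsion_localTowerKer_at_two_le_four_kernel W hgo κ hκ v h2 j'
    exact ⟨hfin, hle.trans (four_le_sq_two_pow_padicValNat_reductionPointCount_two W hgo)⟩
  · rw [if_neg h2]
    obtain ⟨hfin, hle⟩ :=
      pTorsion_le_of_lemma33 lemma33_natCard_localTowerKerPrimary_le_holds W 2 κ hκ v h2 j'
    exact ⟨hfin, hle.trans (hβ κ hκ v hv h2)⟩

/-! ### The rank / `λ_an` / `μ_an` road -/

/-- **Door (TOWER, sharp covers, β-currency; NO tower print binder) for `BSD(E,2)` at analytic rank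
`0`** on a good-ordinary-at-`2` curve with odd torsion order: PRINT {modularity, GZK, Kato 17.4
(1)(2)@2, Greenberg Thm. 4.1@2, Prop. 4.14@2} + CERTIFICATES {`hper₀`, `μ_an = 0`, `λ_an = n`,
`2^n ≤ #Sel_{2^∞}(E/ℚ_{j₀})[2]`, `2^a ≤ #Sel_{2^∞}(E/ℚ_j)[2]`, `#Sel_{2^∞}(E/ℚ_{j'})[2] ≤ 2^d`, `β_v`,
sharp arithmetic} ⇒ `BSDp W 2` — the display `bsdp_two_of_layerSelmer_of_greenberg_sharp` minus
`h33g`/`h33`/`h34`. [cite: GreenbergLNM1716, Thm. 4.1, Prop. 4.14, §3 Lemmas 3.3–3.5]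
[cite: Kato2004Asterisque, Thm. 17.4 (1)(2) (p. 273)] [cite: Miller2011LMS, Def. 1.1] -/
theorem bsdp_two_of_layerSelmer_beta_kernel_sharp (hmod : nonempty_modularParametrizationData)
    (hGZK : rank_eq_analyticRank_of_analyticRank_le_one)
    (h17 : ∀ [NeZero (W.conductorNorm ℤ)] (f : CuspForm (Gamma0 (W.conductorNorm ℤ)) 2),
      kato_divisibility_allPrimes W 2 (f := f))
    (hEC : TwoAdicEulerCharRankZero W 0) (h414 : prop414_noFiniteSubmodule_of_not_dvd_torsionOrder)
    (hper₀ : ∀ [NeZero (W.conductorNorm ℤ)] (f : CuspForm (Gamma0 (W.conductorNorm ℤ)) 2),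
      IsNewformOf W f → ∀ ϖ : ℚ, (ϖ : ℝ) * W.realPeriodRat = plusPeriod f → 0 ≤ padicValRat 2 ϖ)
    (hgo : GoodOrd W 2) (hr : W.analyticRank = 0) (htors : ¬ 2 ∣ W.torsionOrder) {n j₀ j j' a d : ℕ}
    (hrank : ∀ κ : ZpExtension ℚ 2, κ.IsCyclotomic →
      2 ^ n ≤ Nat.card {z : W.selmerLayer κ j₀ // 2 • z = 0})
    (hjj' : j ≤ j') (S : Finset (HeightOneSpectrum (𝓞 ℚ)))
    (hS : ∀ v ∉ S, ((2 : ℕ) : 𝓞 ℚ) ∉ v.asIdeal ∧ W.HasGoodReductionAt v)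
    (β : HeightOneSpectrum (𝓞 ℚ) → ℕ)
    (hβ : ∀ κ : ZpExtension ℚ 2, κ.IsCyclotomic → ∀ v ∈ S, ((2 : ℕ) : 𝓞 ℚ) ∉ v.asIdeal →
      Nat.card (↥(W.localTopPrimary κ (v.adicCompletion ℚ)) ⧸
        W.localTopPrimaryDiv κ (v.adicCompletion ℚ)) ≤ β v)
    (hlow : ∀ κ : ZpExtension ℚ 2, κ.IsCyclotomic →
      2 ^ a ≤ Nat.card {z : W.selmerLayer κ j // 2 • z = 0})
    (hup : ∀ κ : ZpExtension ℚ 2, κ.IsCyclotomic →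
      Nat.card {z : W.selmerLayer κ j' // 2 • z = 0} ≤ 2 ^ d)
    (harith : 2 ^ d * ∏ v ∈ S,
        (if ((2 : ℕ) : 𝓞 ℚ) ∈ v.asIdeal then (2 ^ padicValNat 2 (W.reductionPointCount 2)) ^ 2
          else β v) ^
        (if ((2 : ℕ) : 𝓞 ℚ) ∈ v.asIdeal then 1
          else 2 ^ min j' (padicValNat 2 (Rat.HeightOneSpectrum.natGenerator v ^ 2 - 1) - 3)) <
      2 ^ (2 ^ j' - 2 ^ j + a))
    (hlan : AnalyticLambdaEq W 2 n) (hμan : AnalyticMuLE W 2 0) : BSDp W 2 :=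
  bsdp_two_of_towerGap_of_layerSelmer W hmod hGZK h17 hEC h414 hper₀ hgo hr htors
    (towerGapAtTwo_of_layerSelmer_beta_kernel_sharp W hgo htors hjj' S hS β hβ hlow hup harith)
    hrank hlan hμan

/-- **Door (TOWER, sharp covers, β-currency; NO tower print binder): `MazurMainConjecture W 2`** — any
analytic rank, odd torsion order (the display `mazurMainConjecture_two_of_layerSelmer_of_greenberg_sharp`
minus `h33g`/`h33`/`h34`). [cite: Kato2004Asterisque, Thm. 17.4 (1)(2) (p. 273)]
[cite: GreenbergLNM1716, Prop. 4.14, §3 Lemmas 3.3–3.5] -/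
theorem mazurMainConjecture_two_of_layerSelmer_beta_kernel_sharp
    (h17 : ∀ [NeZero (W.conductorNorm ℤ)] (f : CuspForm (Gamma0 (W.conductorNorm ℤ)) 2),
      kato_divisibility_allPrimes W 2 (f := f))
    (h414 : prop414_noFiniteSubmodule_of_not_dvd_torsionOrder)
    (hper₀ : ∀ [NeZero (W.conductorNorm ℤ)] (f : CuspForm (Gamma0 (W.conductorNorm ℤ)) 2),
      IsNewformOf W f → ∀ ϖ : ℚ, (ϖ : ℝ) * W.realPeriodRat = plusPeriod f → 0 ≤ padicValRat 2 ϖ)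
    (hgo : GoodOrd W 2) (htors : ¬ 2 ∣ W.torsionOrder) {n j₀ j j' a d : ℕ}
    (hrank : ∀ κ : ZpExtension ℚ 2, κ.IsCyclotomic →
      2 ^ n ≤ Nat.card {z : W.selmerLayer κ j₀ // 2 • z = 0})
    (hjj' : j ≤ j') (S : Finset (HeightOneSpectrum (𝓞 ℚ)))
    (hS : ∀ v ∉ S, ((2 : ℕ) : 𝓞 ℚ) ∉ v.asIdeal ∧ W.HasGoodReductionAt v)
    (β : HeightOneSpectrum (𝓞 ℚ) → ℕ)
    (hβ : ∀ κ : ZpExtension ℚ 2, κ.IsCyclotomic → ∀ v ∈ S, ((2 : ℕ) : 𝓞 ℚ) ∉ v.asIdeal →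
      Nat.card (↥(W.localTopPrimary κ (v.adicCompletion ℚ)) ⧸
        W.localTopPrimaryDiv κ (v.adicCompletion ℚ)) ≤ β v)
    (hlow : ∀ κ : ZpExtension ℚ 2, κ.IsCyclotomic →
      2 ^ a ≤ Nat.card {z : W.selmerLayer κ j // 2 • z = 0})
    (hup : ∀ κ : ZpExtension ℚ 2, κ.IsCyclotomic →
      Nat.card {z : W.selmerLayer κ j' // 2 • z = 0} ≤ 2 ^ d)
    (harith : 2 ^ d * ∏ v ∈ S,
        (if ((2 : ℕ) : 𝓞 ℚ) ∈ v.asIdeal then (2 ^ padicValNat 2 (W.reductionPointCount 2)) ^ 2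
          else β v) ^
        (if ((2 : ℕ) : 𝓞 ℚ) ∈ v.asIdeal then 1
          else 2 ^ min j' (padicValNat 2 (Rat.HeightOneSpectrum.natGenerator v ^ 2 - 1) - 3)) <
      2 ^ (2 ^ j' - 2 ^ j + a))
    (hlan : AnalyticLambdaEq W 2 n) (hμan : AnalyticMuLE W 2 0) : MazurMainConjecture W 2 :=
  mazurMainConjecture_two_of_towerGap_of_layerSelmer W h17 h414 hper₀ hgo htors
    (towerGapAtTwo_of_layerSelmer_beta_kernel_sharp W hgo htors hjj' S hS β hβ hlow hup harith)
    hrank hlan hμan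

/-- **The Kato–Néron half (the item `OrdKatoHalfAtTwo` AT `W`), sharp covers, β-currency, NO tower
print binder** (the display `katoHalfAt_two_of_layerSelmer_of_greenberg_sharp` minus `h33g`/`h33`/`h34`).
[cite: Kato2004Asterisque, Thm. 17.4 (1)(2) (p. 273)] [cite: GreenbergLNM1716, Prop. 4.14, §3 Lemmas 3.3–3.5] -/
theorem katoHalfAt_two_of_layerSelmer_beta_kernel_sharp
    (h17 : ∀ [NeZero (W.conductorNorm ℤ)] (f : CuspForm (Gamma0 (W.conductorNorm ℤ)) 2),
      kato_divisibility_allPrimes W 2 (f := f))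
    (h414 : prop414_noFiniteSubmodule_of_not_dvd_torsionOrder)
    (hper₀ : ∀ [NeZero (W.conductorNorm ℤ)] (f : CuspForm (Gamma0 (W.conductorNorm ℤ)) 2),
      IsNewformOf W f → ∀ ϖ : ℚ, (ϖ : ℝ) * W.realPeriodRat = plusPeriod f → 0 ≤ padicValRat 2 ϖ)
    (hgo : GoodOrd W 2) (htors : ¬ 2 ∣ W.torsionOrder) {n j₀ j j' a d : ℕ}
    (hrank : ∀ κ : ZpExtension ℚ 2, κ.IsCyclotomic →
      2 ^ n ≤ Nat.card {z : W.selmerLayer κ j₀ // 2 • z = 0})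
    (hjj' : j ≤ j') (S : Finset (HeightOneSpectrum (𝓞 ℚ)))
    (hS : ∀ v ∉ S, ((2 : ℕ) : 𝓞 ℚ) ∉ v.asIdeal ∧ W.HasGoodReductionAt v)
    (β : HeightOneSpectrum (𝓞 ℚ) → ℕ)
    (hβ : ∀ κ : ZpExtension ℚ 2, κ.IsCyclotomic → ∀ v ∈ S, ((2 : ℕ) : 𝓞 ℚ) ∉ v.asIdeal →
      Nat.card (↥(W.localTopPrimary κ (v.adicCompletion ℚ)) ⧸
        W.localTopPrimaryDiv κ (v.adicCompletion ℚ)) ≤ β v)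
    (hlow : ∀ κ : ZpExtension ℚ 2, κ.IsCyclotomic →
      2 ^ a ≤ Nat.card {z : W.selmerLayer κ j // 2 • z = 0})
    (hup : ∀ κ : ZpExtension ℚ 2, κ.IsCyclotomic →
      Nat.card {z : W.selmerLayer κ j' // 2 • z = 0} ≤ 2 ^ d)
    (harith : 2 ^ d * ∏ v ∈ S,
        (if ((2 : ℕ) : 𝓞 ℚ) ∈ v.asIdeal then (2 ^ padicValNat 2 (W.reductionPointCount 2)) ^ 2
          else β v) ^
        (if ((2 : ℕ) : 𝓞 ℚ) ∈ v.asIdeal then 1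
          else 2 ^ min j' (padicValNat 2 (Rat.HeightOneSpectrum.natGenerator v ^ 2 - 1) - 3)) <
      2 ^ (2 ^ j' - 2 ^ j + a))
    (hlan : AnalyticLambdaEq W 2 n) (hμan : AnalyticMuLE W 2 0) :
    MainConjectureLowerDivisibilityAtTwoOrd W :=
  katoHalfAt_two_of_towerGap_of_layerSelmer W h17 h414 hper₀ hgo htors
    (towerGapAtTwo_of_layerSelmer_beta_kernel_sharp W hgo htors hjj' S hS β hβ hlow hup harith)
    hrank hlan hμan

/-! ### The `Ш`-currency road (rank `0`; no `hrank` / `λ_an` / `μ_an` / Prop. 4.14) -/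

/-- **Door (TOWER gap ∘ `Ш`-currency, sharp covers, β-currency; NO tower print binder) for `BSD(E,2)`
at analytic rank `0`** on a good-ordinary-at-`2` curve with odd torsion order: PRINT {modularity, GZK,
Kato 17.4 (1)(2)@2, Greenberg Thm. 4.1@2} + CERTIFICATES {`hper₀`, `hlow`, `hup`, `β_v`, sharp
arithmetic, `MissingLowerBoundAt W 2`} ⇒ `BSDp W 2` — the display
`bsdp_two_of_layerSelmer_of_greenberg_sharp_of_missingLowerBoundAt` minus `h33g`/`h33`/`h34` (via
bsd-2adic-ord-3's `EisensteinShaCurrency.bsdp_two_of_towerGap_of_missingLowerBoundAt`).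
[cite: GreenbergLNM1716, Thm. 4.1 (p. 102), §3 Lemmas 3.3–3.5] [cite: Kato2004Asterisque, Thm. 17.4 (1)(2) (p. 273)]
[cite: Miller2011LMS, Def. 1.1] [cite: Washington1997, §13.2] -/
theorem bsdp_two_of_layerSelmer_beta_kernel_sharp_of_missingLowerBoundAt
    (hmod : nonempty_modularParametrizationData) (hGZK : rank_eq_analyticRank_of_analyticRank_le_one)
    (h17 : ∀ [NeZero (W.conductorNorm ℤ)] (f : CuspForm (Gamma0 (W.conductorNorm ℤ)) 2),
      kato_divisibility_allPrimes W 2 (f := f))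
    (hEC : TwoAdicEulerCharRankZero W 0)
    (hper₀ : ∀ [NeZero (W.conductorNorm ℤ)] (f : CuspForm (Gamma0 (W.conductorNorm ℤ)) 2),
      IsNewformOf W f → ∀ ϖ : ℚ, (ϖ : ℝ) * W.realPeriodRat = plusPeriod f → 0 ≤ padicValRat 2 ϖ)
    (hgo : GoodOrd W 2) (hr : W.analyticRank = 0) (htors : ¬ 2 ∣ W.torsionOrder) {j j' a d : ℕ}
    (hjj' : j ≤ j') (S : Finset (HeightOneSpectrum (𝓞 ℚ)))
    (hS : ∀ v ∉ S, ((2 : ℕ) : 𝓞 ℚ) ∉ v.asIdeal ∧ W.HasGoodReductionAt v)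
    (β : HeightOneSpectrum (𝓞 ℚ) → ℕ)
    (hβ : ∀ κ : ZpExtension ℚ 2, κ.IsCyclotomic → ∀ v ∈ S, ((2 : ℕ) : 𝓞 ℚ) ∉ v.asIdeal →
      Nat.card (↥(W.localTopPrimary κ (v.adicCompletion ℚ)) ⧸
        W.localTopPrimaryDiv κ (v.adicCompletion ℚ)) ≤ β v)
    (hlow : ∀ κ : ZpExtension ℚ 2, κ.IsCyclotomic →
      2 ^ a ≤ Nat.card {z : W.selmerLayer κ j // 2 • z = 0})
    (hup : ∀ κ : ZpExtension ℚ 2, κ.IsCyclotomic →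
      Nat.card {z : W.selmerLayer κ j' // 2 • z = 0} ≤ 2 ^ d)
    (harith : 2 ^ d * ∏ v ∈ S,
        (if ((2 : ℕ) : 𝓞 ℚ) ∈ v.asIdeal then (2 ^ padicValNat 2 (W.reductionPointCount 2)) ^ 2
          else β v) ^
        (if ((2 : ℕ) : 𝓞 ℚ) ∈ v.asIdeal then 1
          else 2 ^ min j' (padicValNat 2 (Rat.HeightOneSpectrum.natGenerator v ^ 2 - 1) - 3)) <
      2 ^ (2 ^ j' - 2 ^ j + a))
    (hsha : MissingLowerBoundAt W 2) : BSDp W 2 :=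
  EisensteinShaCurrency.bsdp_two_of_towerGap_of_missingLowerBoundAt W h17 hper₀ hEC hGZK hmod hgo hr
    (towerGapAtTwo_of_layerSelmer_beta_kernel_sharp W hgo htors hjj' S hS β hβ hlow hup harith) hsha

/-- **Door (TOWER gap ∘ `Ш`-currency, sharp covers, β-currency; NO tower print binder): the `2`-adic
main conjecture `MazurMainConjecture W 2`** at a rank-`0` good-ordinary `W` with odd torsion order — the
display `mazurMainConjecture_two_of_layerSelmer_of_greenberg_sharp_of_missingLowerBoundAt` minus
`h33g`/`h33`/`h34`; in particular the item `OrdKatoHalfAtTwo` AT `W` (the `⊆` half).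
[cite: Kato2004Asterisque, Thm. 17.4 (1)(2) (p. 273)] [cite: GreenbergLNM1716, Thm. 4.1 (p. 102), §3 Lemmas 3.3–3.5]
[cite: Washington1997, §13.2] -/
theorem mazurMainConjecture_two_of_layerSelmer_beta_kernel_sharp_of_missingLowerBoundAt
    (hmod : nonempty_modularParametrizationData) (hGZK : rank_eq_analyticRank_of_analyticRank_le_one)
    (h17 : ∀ [NeZero (W.conductorNorm ℤ)] (f : CuspForm (Gamma0 (W.conductorNorm ℤ)) 2),
      kato_divisibility_allPrimes W 2 (f := f))
    (hEC : TwoAdicEulerCharRankZero W 0)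
    (hper₀ : ∀ [NeZero (W.conductorNorm ℤ)] (f : CuspForm (Gamma0 (W.conductorNorm ℤ)) 2),
      IsNewformOf W f → ∀ ϖ : ℚ, (ϖ : ℝ) * W.realPeriodRat = plusPeriod f → 0 ≤ padicValRat 2 ϖ)
    (hgo : GoodOrd W 2) (hr : W.analyticRank = 0) (htors : ¬ 2 ∣ W.torsionOrder) {j j' a d : ℕ}
    (hjj' : j ≤ j') (S : Finset (HeightOneSpectrum (𝓞 ℚ)))
    (hS : ∀ v ∉ S, ((2 : ℕ) : 𝓞 ℚ) ∉ v.asIdeal ∧ W.HasGoodReductionAt v)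
    (β : HeightOneSpectrum (𝓞 ℚ) → ℕ)
    (hβ : ∀ κ : ZpExtension ℚ 2, κ.IsCyclotomic → ∀ v ∈ S, ((2 : ℕ) : 𝓞 ℚ) ∉ v.asIdeal →
      Nat.card (↥(W.localTopPrimary κ (v.adicCompletion ℚ)) ⧸
        W.localTopPrimaryDiv κ (v.adicCompletion ℚ)) ≤ β v)
    (hlow : ∀ κ : ZpExtension ℚ 2, κ.IsCyclotomic →
      2 ^ a ≤ Nat.card {z : W.selmerLayer κ j // 2 • z = 0})
    (hup : ∀ κ : ZpExtension ℚ 2, κ.IsCyclotomic →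
      Nat.card {z : W.selmerLayer κ j' // 2 • z = 0} ≤ 2 ^ d)
    (harith : 2 ^ d * ∏ v ∈ S,
        (if ((2 : ℕ) : 𝓞 ℚ) ∈ v.asIdeal then (2 ^ padicValNat 2 (W.reductionPointCount 2)) ^ 2
          else β v) ^
        (if ((2 : ℕ) : 𝓞 ℚ) ∈ v.asIdeal then 1
          else 2 ^ min j' (padicValNat 2 (Rat.HeightOneSpectrum.natGenerator v ^ 2 - 1) - 3)) <
      2 ^ (2 ^ j' - 2 ^ j + a))
    (hsha : MissingLowerBoundAt W 2) : MazurMainConjecture W 2 :=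
  EisensteinShaCurrency.mazurMainConjecture_two_of_towerGap_of_missingLowerBoundAt W h17 hper₀ hEC
    hGZK hmod hgo hr
    (towerGapAtTwo_of_layerSelmer_beta_kernel_sharp W hgo htors hjj' S hS β hβ hlow hup harith) hsha

end Curve

end Summit.BirchSwinnertonDyer.BirchSwinnertonDyer.Theorems.KatoHalfPinch

end
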